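import Summits.Ventures.Crystal3D.Theorems.StickyWulffConstantNoReconstructionGainMultiFrameFilm
import Summits.Ventures.Crystal3D.Theorems.StickyWulffConstantNoReconstructionGainBarlowGrainFrame
import HarnessLib

/-!
# Misoriented grains of ANY Barlow stacking in the basal cone gain nothing (rung `barlowGrainFilm_slab`)

HONEST FRAMING. Part of the venture `Summits/Ventures/Crystal3D` (cell `crystal3d-full`), helper
`--supports` the crux `NoReconstructionGain` (stmt-Ventures-19144, route
`route-Ventures-StickyWulffConstant`), line `adhesion` (wulff-p1 g13).  The multi-frame rung
`multiFrameGrainFilm_slab` (`…MultiFrameFilm`, g12) INSTANTIATED for the concrete class it was designed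
for: a film contained in a rigidly moved Barlow stacking `A · barlowStacking 1 √(2/3) σ + c` of an
ARBITRARY Hägg word `σ` (fcc, hcp, dhcp, twinned and faulted fcc, any mixture), whose stacking axis
`A e₃` makes an angle `< 54.7°` with the cut normal `ν` (`⟪ν, A e₃⟫ > 1/√3`).

The frame of a film ball `q` of layer `k` is the moved fcc bond star that contains its six in-plane
bonds and its three DOWN bonds: `A · U₀` if the bilayer `(k − 1, k)` is of fcc type (`σ (k−1) = 1`),
`A · M U₀` (`M` = the basal mirror `x₃ ↦ −x₃`) if it is of twin type (`σ (k−1) = −1`).  Then every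
film contact of `q` is registered in `q`'s frame, except an up bond of the other type, which is a
mirrored out-of-plane bond: interstitial (`⟪M v, d⟫ ≤ 5/6 ≤ √3/2`, `inner_basalMirror_fcc_unit_le` of
`…BarlowGrainFrame`) and strictly `ν`-above `q` inside the basal cone (`inner_pos_of_basal_tilt`).
The layer index of a film ball (hence its frame) is read off unambiguously because `A` is injective and
layers have distinct heights.

* `barlowGrainFilm_slab` (**rung, registered by name on stmt-Ventures-19144**): for every Hägg word
  `σ`, every linear isometry `A` and shift `c` with `⟪ν, A e₃⟫ > 1/√3`, at every unit normal `ν` and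
  every `ρ ≥ R`: a finite unit packing `X ⊇ P` (the fcc slab sample) whose film balls lie above the cut,
  off `Λ₀`, and inside `A · barlowStacking 1 √(2/3) σ + c`, satisfies `#cross(P, X∖P) ≤ D(X∖P) + C ρ`
  (constants of `multiFrameGrainFilm_slab`: `R = 1`, `C = 0`).  Class (iii″) of the line's census —
  misoriented grains of any close-packed polytype in the basal cone — is closed in the kernel.

WHAT THIS IS NOT: the crux.  Barlow-type grains tilted BEYOND the basal cone (`⟪ν, A e₃⟫ ≤ 1/√3`:
the up bonds of one bilayer type are not `ν`-above; pure fcc grains are covered at every tilt by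
`grainFilm_slab`), on-lattice coincidence balls, polycrystalline and amorphous films are not covered;
rung F-C1 not moved.
-/

noncomputable section

namespace Summit.Ventures.Crystal3D.Theorems

open Summit.Ventures.Crystal3D Finset
open Literature.MathematicalPhysics.StatisticalMechanics (fccStacking barlowStacking barlowPos constHagg
  haggLabel IsHaggSeq contactDeficiency barlowPos_apply_zero barlowPos_apply_one barlowPos_apply_two
  haggLabel_const haggLabel_succ dist_barlowPos_eq_iff isHaggSeq_const mem_barlowStacking_iff)
open scoped InnerProductSpace

/-! ### The rung -/

/-- **RUNG (registered by name on stmt-Ventures-19144): misoriented grains of ANY Barlow stacking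
in the basal cone gain nothing, at every normal.**  For every Hägg word `σ`, every linear isometry
`A` and shift `c` with `⟪ν, A e₃⟫ > 1/√3` (stacking axis within `54.7°` of the cut normal), at every
unit normal `ν` and every `ρ ≥ R`: a finite unit packing `X ⊇ P` containing the fcc slab sample `P`,
whose film balls lie above the cut, off `Λ₀`, and inside the moved stacking
`A · barlowStacking 1 √(2/3) σ + c`, satisfies `#cross(P, X∖P) ≤ D(X∖P) + C ρ`. -/
theorem barlowGrainFilm_slab :
    ∃ R C : ℝ, 1 ≤ R ∧ ∀ σ : ℤ → ℤ, IsHaggSeq σ →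
      ∀ (A : EuclideanSpace ℝ (Fin 3) ≃ₗᵢ[ℝ] EuclideanSpace ℝ (Fin 3)) (c : EuclideanSpace ℝ (Fin 3)),
      ∀ ν : EuclideanSpace ℝ (Fin 3), ‖ν‖ = 1 →
      1 / Real.sqrt 3 < ⟪ν, A (EuclideanSpace.single (2 : Fin 3) (1 : ℝ))⟫_ℝ →
      ∀ ρ : ℝ, R ≤ ρ →
      ∀ X P : Finset (EuclideanSpace ℝ (Fin 3)),
      (∀ p ∈ X, ∀ q ∈ X, p ≠ q → 1 ≤ dist p q) → P ⊆ X →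
      (∀ p, p ∈ P ↔ (p ∈ fccStacking 1 (Real.sqrt (2 / 3)) ∧ -(2 * R) ≤ ⟪p, ν⟫_ℝ ∧
        ⟪p, ν⟫_ℝ ≤ -R ∧ ‖p‖ ^ 2 - ⟪p, ν⟫_ℝ ^ 2 ≤ ρ ^ 2)) →
      (∀ q ∈ X \ P, -R < ⟪q, ν⟫_ℝ) →
      (∀ q ∈ X \ P, q ∉ fccStacking 1 (Real.sqrt (2 / 3))) →
      (∀ q ∈ X \ P, q ∈ (fun p => A p + c) '' barlowStacking 1 (Real.sqrt (2 / 3)) σ) →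
      ((((P ×ˢ (X \ P)).filter fun pq => dist pq.1 pq.2 = 1).card : ℕ) : ℝ) ≤
        contactDeficiency (X \ P) + C * ρ := by
  classical
  obtain ⟨R, C, hR, h⟩ := multiFrameGrainFilm_slab
  refine ⟨R, C, hR, ?_⟩
  intro σ hσ A c ν hν htilt ρ hρ X P hX hPX hP habove hoff hgrain
  -- the explicit bond star
  set U₀ : Finset (EuclideanSpace ℝ (Fin 3)) :=
    ([barlowPos 1 (Real.sqrt (2 / 3)) constHagg 0 1 0, -barlowPos 1 (Real.sqrt (2 / 3)) constHagg 0 1 0,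
        barlowPos 1 (Real.sqrt (2 / 3)) constHagg 0 0 1, -barlowPos 1 (Real.sqrt (2 / 3)) constHagg 0 0 1,
        barlowPos 1 (Real.sqrt (2 / 3)) constHagg 0 1 (-1), -barlowPos 1 (Real.sqrt (2 / 3)) constHagg 0 1 (-1),
        barlowPos 1 (Real.sqrt (2 / 3)) constHagg 1 0 0, -barlowPos 1 (Real.sqrt (2 / 3)) constHagg 1 0 0,
        barlowPos 1 (Real.sqrt (2 / 3)) constHagg (-1) 1 0, -barlowPos 1 (Real.sqrt (2 / 3)) constHagg (-1) 1 0,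
        barlowPos 1 (Real.sqrt (2 / 3)) constHagg (-1) 0 1, -barlowPos 1 (Real.sqrt (2 / 3)) constHagg (-1) 0 1] :
        List (EuclideanSpace ℝ (Fin 3))).toFinset with hU₀
  have hU₀mem : ∀ d ∈ U₀, d ∈ fccStacking 1 (Real.sqrt (2 / 3)) ∧ ‖d‖ = 1 := fun d hd => fccBondStar_mem hd
  have hU₀neg : ∀ d ∈ U₀, -d ∈ U₀ := fun d hd => fccBondStar_neg_mem hd
  have hU₀card : U₀.card = 12 := fccBondStar_card
  -- the basal mirror and the frames
  set e₃ : EuclideanSpace ℝ (Fin 3) := EuclideanSpace.single (2 : Fin 3) (1 : ℝ) with he₃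
  set M : EuclideanSpace ℝ (Fin 3) ≃ₗᵢ[ℝ] EuclideanSpace ℝ (Fin 3) := (ℝ ∙ e₃)ᗮ.reflection with hM
  have hMM : ∀ v, M (M v) = v := fun v => Submodule.reflection_reflection _ v
  set Af : EuclideanSpace ℝ (Fin 3) → (EuclideanSpace ℝ (Fin 3) ≃ₗᵢ[ℝ] EuclideanSpace ℝ (Fin 3)) :=
    fun q => if (∃ k i j : ℤ, σ (k - 1) = -1 ∧ A (barlowPos 1 (Real.sqrt (2 / 3)) σ k i j) + c = q)
      then M.trans A else A with hAf
  refine h U₀ hU₀mem hU₀neg hU₀card Af ν hν ρ hρ X P hX hPX hP habove hoff ?_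
  intro q hq x hx hqx
  obtain ⟨q', hq'mem, hq'⟩ := hgrain q hq
  obtain ⟨x', hx'mem, hx'⟩ := hgrain x hx
  obtain ⟨k, i, j, rfl⟩ := mem_barlowStacking_iff.1 hq'mem
  obtain ⟨k', i', j', rfl⟩ := mem_barlowStacking_iff.1 hx'mem
  set v := barlowPos 1 (Real.sqrt (2 / 3)) σ k' i' j' - barlowPos 1 (Real.sqrt (2 / 3)) σ k i j with hv
  have hxq : x - q = A v := by rw [← hq', ← hx', hv, map_sub, add_sub_add_right_eq_sub]
  have hd : dist (barlowPos 1 (Real.sqrt (2 / 3)) σ k i j) (barlowPos 1 (Real.sqrt (2 / 3)) σ k' i' j') = 1 := by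
    have := hqx
    rwa [← hq', ← hx', dist_add_right, LinearIsometryEquiv.dist_map] at this
  have hv1 : ‖v‖ = 1 := by rw [hv, ← dist_eq_norm, dist_comm, hd]
  have hh0 : Real.sqrt (2 / 3) ≠ 0 := Real.sqrt_ne_zero'.2 (by norm_num)
  -- the frame at `q` is decided by the letter `σ (k − 1)`
  have hAfq : Af q = if σ (k - 1) = -1 then M.trans A else A := by
    by_cases hs : σ (k - 1) = -1
    · simp only [hAf]; rw [if_pos ⟨k, i, j, hs, hq'⟩, if_pos hs]
    · simp only [hAf]; rw [if_neg ?_, if_neg hs]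
      rintro ⟨k₂, i₂, j₂, hs₂, hq₂⟩
      have heq : barlowPos 1 (Real.sqrt (2 / 3)) σ k₂ i₂ j₂ = barlowPos 1 (Real.sqrt (2 / 3)) σ k i j :=
        A.injective (add_right_cancel (hq₂.trans hq'.symm))
      have hk2 : (k₂ : ℝ) * Real.sqrt (2 / 3) = k * Real.sqrt (2 / 3) := by
        have := congrArg (fun p : EuclideanSpace ℝ (Fin 3) => p 2) heq
        simpa only [barlowPos_apply_two] using this
      have hk : k₂ = k := by exact_mod_cast mul_right_cancel₀ hh0 hk2
      exact hs (hk ▸ hs₂)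
  -- `A`-frame and `A M`-frame pull-backs of the bond
  have hpullA : A.symm (x - q) = v := by rw [hxq, LinearIsometryEquiv.symm_apply_apply]
  have hpullM : (M.trans A).symm (x - q) = M v := by
    apply (M.trans A).injective
    rw [LinearIsometryEquiv.apply_symm_apply, LinearIsometryEquiv.trans_apply, hMM, hxq]
  -- up bonds are `ν`-above
  have hn1 : ‖A.symm ν‖ = 1 := by rw [LinearIsometryEquiv.norm_map, hν]
  have hn2 : 1 / Real.sqrt 3 < (A.symm ν) 2 := by
    rw [← bgf_inner_e3_left, real_inner_comm, ← he₃]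
    have : ⟪A.symm ν, e₃⟫_ℝ = ⟪ν, A e₃⟫_ℝ := by
      rw [← LinearIsometryEquiv.inner_map_map A (A.symm ν) e₃, LinearIsometryEquiv.apply_symm_apply]
    rw [this]; exact htilt
  have habove_of : v 2 = Real.sqrt (2 / 3) → ⟪q, ν⟫_ℝ < ⟪x, ν⟫_ℝ := by
    intro hv2
    have hpos : 0 < ⟪v, A.symm ν⟫_ℝ := inner_pos_of_basal_tilt hv1 hv2 hn1 hn2
    have : ⟪x - q, ν⟫_ℝ = ⟪v, A.symm ν⟫_ℝ := by
      rw [hxq, ← LinearIsometryEquiv.inner_map_map A v (A.symm ν), LinearIsometryEquiv.apply_symm_apply]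
    rw [inner_sub_left] at this
    linarith
  -- interstitial test for a mirrored out-of-plane bond of `Λ₀`
  have hinter : ∀ u : EuclideanSpace ℝ (Fin 3), u ∈ fccStacking 1 (Real.sqrt (2 / 3)) → ‖u‖ = 1 → u 2 ≠ 0 →
      ∀ d ∈ U₀, ⟪M u, d⟫_ℝ ≤ Real.sqrt 3 / 2 := by
    intro u hu hu1 hu2 d hdU
    rw [hM, he₃]
    exact inner_basalMirror_fcc_unit_le hu (hU₀mem d hdU).1 hu1 (hU₀mem d hdU).2 hu2
  -- layer classification of the contact
  have hcases := (dist_barlowPos_eq_iff (a := (1 : ℝ)) hσ one_pos fcc_height_sq k i j k' i' j').1 hd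
  rcases hcases with ⟨hk', -⟩ | ⟨hk', -⟩ | ⟨hk', -⟩
  · -- in-layer bond: registered in either frame
    subst k'
    have hvfcc : v = barlowPos 1 (Real.sqrt (2 / 3)) constHagg 0 (i' - i) (j' - j) := barlowPos_sub_eq_fcc σ k i j i' j'
    have hvmem : v ∈ fccStacking 1 (Real.sqrt (2 / 3)) := hvfcc ▸ ⟨0, i' - i, j' - j, rfl⟩
    have hv2 : v 2 = 0 := by rw [hvfcc, barlowPos_apply_two]; push_cast; ring
    left
    rw [hAfq]
    split_ifs
    · rw [hpullM, hM, he₃, basalMirror_of_apply_two_eq_zero hv2]; exact hvmem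
    · rw [hpullA]; exact hvmem
  · -- up bond
    subst k'
    have hv2 : v 2 = Real.sqrt (2 / 3) := barlowPos_succ_sub_apply_two σ k i j i' j'
    rcases hσ k with hsk | hsk
    · -- fcc-type bilayer above: `v ∈ Λ₀`
      have hvfcc : v = barlowPos 1 (Real.sqrt (2 / 3)) constHagg 1 (i' - i) (j' - j) :=
        barlowPos_succ_sub_of_pos hsk i j i' j'
      have hvmem : v ∈ fccStacking 1 (Real.sqrt (2 / 3)) := hvfcc ▸ ⟨1, i' - i, j' - j, rfl⟩
      rw [hAfq]
      split_ifs
      · -- twin frame: mirrored fcc up bond is interstitial and above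
        right
        refine ⟨fun d hdU => ?_, habove_of hv2⟩
        rw [hpullM]
        exact hinter v hvmem hv1 (by rw [hv2]; exact hh0) d hdU
      · left; rw [hpullA]; exact hvmem
    · -- twin-type bilayer above: `M v ∈ Λ₀`
      have hMv : M v = barlowPos 1 (Real.sqrt (2 / 3)) constHagg (-1) (i' - i) (j' - j) := by
        rw [hM, he₃]; exact basalMirror_barlowPos_succ_sub_of_neg hsk i j i' j'
      have hMvmem : M v ∈ fccStacking 1 (Real.sqrt (2 / 3)) := hMv ▸ ⟨-1, i' - i, j' - j, rfl⟩
      rw [hAfq]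
      split_ifs
      · left; rw [hpullM]; exact hMvmem
      · -- fcc frame: the twin up bond `v = M (M v)` is interstitial and above
        right
        refine ⟨fun d hdU => ?_, habove_of hv2⟩
        rw [hpullA, ← hMM v]
        refine hinter (M v) hMvmem (by rw [LinearIsometryEquiv.norm_map, hv1]) ?_ d hdU
        rw [hMv, barlowPos_apply_two]; push_cast
        intro h0; apply hh0; linarith
  · -- down bond: registered in the frame of its own bilayer
    subst k'
    rcases hσ (k - 1) with hsk | hsk
    · have hvfcc : v = barlowPos 1 (Real.sqrt (2 / 3)) constHagg (-1) (i' - i) (j' - j) :=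
        barlowPos_pred_sub_of_pos hsk i j i' j'
      have hvmem : v ∈ fccStacking 1 (Real.sqrt (2 / 3)) := hvfcc ▸ ⟨-1, i' - i, j' - j, rfl⟩
      left
      rw [hAfq, if_neg (by rw [hsk]; norm_num), hpullA]; exact hvmem
    · have hMv : M v = barlowPos 1 (Real.sqrt (2 / 3)) constHagg 1 (i' - i) (j' - j) := by
        rw [hM, he₃]; exact basalMirror_barlowPos_pred_sub_of_neg hsk i j i' j'
      have hMvmem : M v ∈ fccStacking 1 (Real.sqrt (2 / 3)) := hMv ▸ ⟨1, i' - i, j' - j, rfl⟩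
      left
      rw [hAfq, if_pos hsk, hpullM]; exact hMvmem

end Summit.Ventures.Crystal3D.Theorems

end
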